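import Literature.AnabelianGeometry.EtaleTheta.Discharge.Sec3Cor38GenuineBaseNV

/-!
# [EtTh] Corollary 3.8 (i)/(ii): the CONCLUSIONS over THE base category of [EtTh] §§3–5, `B^temp(Π^tp_X)⁰`, for the
# tempered fundamental group of a hyperbolic curve — and the closed instance `Π = 1`

Mochizuki, *The étale theta function and its Frobenioid-theoretic manifestations*, Publ. RIMS **45** (2009),
Cor. 3.8 (i)/(ii), PDF pp. 80–82 [cite: MochizukiEtTh2009, Cor 3.8 p.80]; Mochizuki, *Semi-graphs of anabelioids*
(2006), Example 3.10 (the tempered fundamental group of a hyperbolic curve over an MLF is tempered and temp-slim)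
[cite: MochizukiSemiAnbd2006, Ex. 3.10 p.43].

abc-iut cell, layer L2, cone nodes `EtTh:Cor3.8(i)` / `EtTh:Cor3.8(ii)`; seat abc-iut-w6-d039 (gen 3); PROOF-ONLY
(0 definitions) corollary sheet of abc-iut-w6-d040's `Discharge/Sec3Cor38GenuineBaseNV.lean` (p440762), which runs
the (i)/(ii) node closers (this lineage's `Cor38Hyp.cor38_i_ofRlfZ_of_structural`, p438712; w6-d040's (ii) twin) at
abc-iut-w6-d048's constructed tempered Frobenioid `Toy.genuineTemperedFrobenioidConnectedPart Π R S` over print's base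
`B^temp(Π)⁰` and derives the CONCLUSIONS of Cor. 3.8 (i)/(ii) for `Π` tempered and temp-slim (`hG`, `hZ`).  THIS FILE
instantiates those two hypotheses:

* at `Π := Π^tp_X` for abc-iut-L3-t2's tempered arithmetic fundamental group `X : TemperedArithmeticGroup K` of a
  hyperbolic curve — THE base category `B^temp(Π^tp_X)⁰` of [EtTh] §§3–5 (slim: abc-iut-L3's
  `TemperedArithmeticGroup.isSlim_connectedPart`, [SemiAnbd] Ex. 3.10): `Toy.preservesBaseFieldTheoretic_genuineConnectedPart_curve`,
  `Toy.cor38_ii_conclusion_genuineConnectedPart_curve` — for EVERY inhabitant `h` of `Cor38Hyp`, no further hypothesis;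
* at `Π := 1` (tempered: countable discrete; temp-slim trivially — abc-iut-w6-d048's `Toy.isSlimGroup_punit`):
  `Toy.preservesBaseFieldTheoretic_genuineConnectedPart_punit`, `Toy.cor38_ii_conclusion_genuineConnectedPart_punit`,
  and the `∃`-forms — closed, hypothesis-free kernel instances of both conclusions.

HONEST LABEL: genuine BASE (`B^temp(Π^tp_X)⁰`), DEGENERATE divisor data (one prime, `Λ = ℤ`, constant functions,
constant base functor): instantiation witnesses only — NOT the tempered Frobenioid of the curve.  Refereed pre-IUT
material; nothing here bears on [IUTchIII] Cor. 3.12; no side taken; typed ≠ proved.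
-/

noncomputable section

namespace Literature.AnabelianGeometry.EtaleTheta

open CategoryTheory Opposite Function Literature.AlgebraicGeometry.Frobenioids
  Literature.AnabelianGeometry.SemiGraphs

universe u u'

namespace Toy

section Curve

variable {K : Type u} [Field K] (X : TemperedArithmeticGroup K)
  (R S : ((ConnectedPart (BTemp X.Pi))ᵒᵖ ⥤ CommMonCat.{0}) → Prop)

/-- **The conclusion of Cor. 3.8 (i) over `B^temp(Π^tp_X)⁰`**, THE base category of [EtTh] §§3–5 for the tempered
arithmetic fundamental group `X` of a hyperbolic curve (tempered and temp-slim, [SemiAnbd] Ex. 3.10), at the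
constructed tempered Frobenioid over it, for every inhabitant `h` of `Cor38Hyp` — no further hypothesis.
[cite: MochizukiEtTh2009, Cor 3.8 p.80] -/
theorem preservesBaseFieldTheoretic_genuineConnectedPart_curve
    (h : Cor38Hyp (genuineTemperedFrobenioidConnectedPart X.Pi R S)
      (genuineTemperedFrobenioidConnectedPart X.Pi R S)) :
    Literature.AnabelianGeometry.EtaleTheta.PreservesBaseFieldTheoretic h :=
  preservesBaseFieldTheoretic_genuineConnectedPart X.Pi R S X.isTempered X.isSlimGroup h

/-- **The conclusion of Cor. 3.8 (ii) over `B^temp(Π^tp_X)⁰`**: `Ψ` preserves the base-field-theoretic morphisms AND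
induces a compatible self-equivalence of the hull `C^{bs-fld}`, for every `h`. [cite: MochizukiEtTh2009, Cor 3.8 p.81] -/
theorem cor38_ii_conclusion_genuineConnectedPart_curve
    (h : Cor38Hyp (genuineTemperedFrobenioidConnectedPart X.Pi R S)
      (genuineTemperedFrobenioidConnectedPart X.Pi R S)) :
    Literature.AnabelianGeometry.EtaleTheta.PreservesBaseFieldTheoretic h ∧
      ∃ Ψbs : (genuineTemperedFrobenioidConnectedPart X.Pi R S).hullCategory ≌
          (genuineTemperedFrobenioidConnectedPart X.Pi R S).hullCategory,
        Nonempty ((genuineTemperedFrobenioidConnectedPart X.Pi R S).hull ⋙ h.Ψ.functor ≅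
          Ψbs.functor ⋙ (genuineTemperedFrobenioidConnectedPart X.Pi R S).hull) :=
  cor38_ii_conclusion_genuineConnectedPart X.Pi R S X.isTempered X.isSlimGroup h

/-- `∃`-form over `B^temp(Π^tp_X)⁰` (`Ψ := 𝟭`): both conclusions have kernel instances over THE base of [EtTh] §§3–5
with no hypothesis on `X`. [cite: MochizukiEtTh2009, Cor 3.8 p.80] -/
theorem exists_cor38_conclusions_genuineConnectedPart_curve :
    ∃ h : Cor38Hyp (genuineTemperedFrobenioidConnectedPart X.Pi R S)
        (genuineTemperedFrobenioidConnectedPart X.Pi R S),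
      Literature.AnabelianGeometry.EtaleTheta.PreservesBaseFieldTheoretic h ∧
        ∃ Ψbs : (genuineTemperedFrobenioidConnectedPart X.Pi R S).hullCategory ≌
            (genuineTemperedFrobenioidConnectedPart X.Pi R S).hullCategory,
          Nonempty ((genuineTemperedFrobenioidConnectedPart X.Pi R S).hull ⋙ h.Ψ.functor ≅
            Ψbs.functor ⋙ (genuineTemperedFrobenioidConnectedPart X.Pi R S).hull) :=
  exists_cor38_ii_conclusion_genuineConnectedPart X.Pi R S X.isTempered X.isSlimGroup

end Curve

section Trivial

variable (R S : ((ConnectedPart (BTemp PUnit.{u' + 1}))ᵒᵖ ⥤ CommMonCat.{0}) → Prop)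

/-- **Closed instance `Π = 1`**: the conclusion of Cor. 3.8 (i) over `B^temp(1)⁰` for every `h`, with no hypothesis
at all (the trivial group is tempered — countable discrete — and temp-slim). [cite: MochizukiEtTh2009, Cor 3.8 p.80] -/
theorem preservesBaseFieldTheoretic_genuineConnectedPart_punit
    (h : Cor38Hyp (genuineTemperedFrobenioidConnectedPart PUnit.{u' + 1} R S)
      (genuineTemperedFrobenioidConnectedPart PUnit.{u' + 1} R S)) :
    Literature.AnabelianGeometry.EtaleTheta.PreservesBaseFieldTheoretic h :=
  preservesBaseFieldTheoretic_genuineConnectedPart PUnit.{u' + 1} R S isTempered_of_discreteTopology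
    isSlimGroup_punit h

/-- **Closed instance `Π = 1`** for the conclusion of Cor. 3.8 (ii). [cite: MochizukiEtTh2009, Cor 3.8 p.81] -/
theorem cor38_ii_conclusion_genuineConnectedPart_punit
    (h : Cor38Hyp (genuineTemperedFrobenioidConnectedPart PUnit.{u' + 1} R S)
      (genuineTemperedFrobenioidConnectedPart PUnit.{u' + 1} R S)) :
    Literature.AnabelianGeometry.EtaleTheta.PreservesBaseFieldTheoretic h ∧
      ∃ Ψbs : (genuineTemperedFrobenioidConnectedPart PUnit.{u' + 1} R S).hullCategory ≌
          (genuineTemperedFrobenioidConnectedPart PUnit.{u' + 1} R S).hullCategory,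
        Nonempty ((genuineTemperedFrobenioidConnectedPart PUnit.{u' + 1} R S).hull ⋙ h.Ψ.functor ≅
          Ψbs.functor ⋙ (genuineTemperedFrobenioidConnectedPart PUnit.{u' + 1} R S).hull) :=
  cor38_ii_conclusion_genuineConnectedPart PUnit.{u' + 1} R S isTempered_of_discreteTopology isSlimGroup_punit h

/-- **Hypothesis-free `∃`-form at `Π = 1`**: both conclusions of Cor. 3.8 (i)/(ii) have CLOSED kernel instances over a
genuine connected-temperoid base. [cite: MochizukiEtTh2009, Cor 3.8 p.80] -/
theorem exists_cor38_conclusions_genuineConnectedPart_punit :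
    ∃ h : Cor38Hyp (genuineTemperedFrobenioidConnectedPart PUnit.{u' + 1} R S)
        (genuineTemperedFrobenioidConnectedPart PUnit.{u' + 1} R S),
      Literature.AnabelianGeometry.EtaleTheta.PreservesBaseFieldTheoretic h ∧
        ∃ Ψbs : (genuineTemperedFrobenioidConnectedPart PUnit.{u' + 1} R S).hullCategory ≌
            (genuineTemperedFrobenioidConnectedPart PUnit.{u' + 1} R S).hullCategory,
          Nonempty ((genuineTemperedFrobenioidConnectedPart PUnit.{u' + 1} R S).hull ⋙ h.Ψ.functor ≅
            Ψbs.functor ⋙ (genuineTemperedFrobenioidConnectedPart PUnit.{u' + 1} R S).hull) :=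
  exists_cor38_ii_conclusion_genuineConnectedPart PUnit.{u' + 1} R S isTempered_of_discreteTopology
    isSlimGroup_punit

end Trivial

end Toy

end Literature.AnabelianGeometry.EtaleTheta

end
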